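/-
Copyright (c) 2026 the pub-hodgecm-mathlib formalisation cell (harness21).  Prover seat hodgecm-mathlib-K2E3-p03 (g9) (valve hand; LEAD F0P6-plan (g14) BATCH #139 (2)
«(ρ4) → K2E3-p03: `Theorems/K2LiuKindOneLineCornerGramBound.lean`», line lead ∕ (K1b-♮) writer K2Liu-p14 (g4) LINE WORD #6 (Q2) design note, memo v4 §8 of LH4-p14 (g7)):
Track B «K2-LIT», hLiu418 = stmt-HodgeConjecture-24832, road `K2_Liu`, socket #41, KIND 1, organ (K1b-W), letter (ρ4) — EDITION 1: the definition-free tube-frame core.  2026-09-04.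
-/
import Mathlib.Analysis.Matrix.Normed
import Mathlib.Analysis.Complex.Basic
import Mathlib.LinearAlgebra.Matrix.ConjTranspose
import Mathlib.Algebra.Order.Chebyshev
import HarnessLib

/-!
# Crux `HLiu418`, socket #41, KIND 1 ∕ organ (K1b-W), letter (ρ4) `K2LiuKindOneLineCornerGramBound` — EDITION 1: THE TUBE-FRAME CORE OF THE GRAM BOUND
# «the rank-one index moved by the Iwasawa Levi block cannot be small»: `c·|v_i||v_j| ≤ n·M²·Σ_k |(Aᴴ v)_k|²` whenever `A·A′ = 1` with `|A′_{kl}| ≤ M`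

Cell `hodgecm-mathlib`, crux item hLiu418 = `stmt-HodgeConjecture-24832` (helper lane `--supports stmt-HodgeConjecture-24832 --as helper`, count-neutral); squad K2 ∕ K2Liu,
road `K2_Liu`, socket #41, KIND 1, organ (K1b-W) ((K1b-♮) writer K2Liu-p14 (g4); desk successor K2E5-p16 (g8)); prover K2E3-p03 (g9).  THEOREMS ONLY (no `def`, no `instance`,
no notation, no named-fact hypothesis, no `sorry`); Mathlib only.

THE LETTER (ρ4) (line lead K2Liu-p14 (g4) LINE WORD #6 (Q2), LH4-p14 (g7) memo v4 §8): the S-UNIFORM decay `hdecb` of the K1-b♮ line term is read on the corner road in the FINE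
form (★ p862865 `norm_lineWhittaker_iwasawa_le`: `e^{−π |μ| ‖a₀₀‖²}` at the Iwasawa point) and needs the MATRIX INEQUALITY
  `|σ♭(S)|_w · ‖a₀₀(x(Λĝ(S)·h)_w)‖² = ‖A_wᴴ v_w‖²  ≥  λ_min(A_w A_wᴴ) · τ_w(S)  ≳  H(h_∞)^{−2} · τ_w(S)`
(`h_w = n·m(A_w)·k` Iwasawa, `S_w = σ·v vᴴ` the rank-one index at `w`; the row mover `ĝ` CANCELS).  THIS EDITION is the DEFINITION-FREE CORE of the two inequalities — pure
matrix algebra over `ℂ` in the sup-norm currency of ★ G7-B `block_entry_bounds` («the inverse of the Iwasawa Levi block has entries `≤ M`, `M ~ H(h_∞)`»):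
* §1 **`norm_apply_le_of_mul_eq_one`** — `A·A′ = 1`, `|A′_{kl}| ≤ M` ⟹ `|v_i| ≤ M · Σ_k |(Aᴴ v)_k|` for every vector `v` (`v = A′ᴴ (Aᴴ v)`); squared with Cauchy–Schwarz:
  **`norm_apply_sq_le`** — `|v_i|² ≤ n·M²·Σ_k |(Aᴴ v)_k|²` (this is `λ_min(A Aᴴ) ≥ (n M²)⁻¹` without eigenvalues).
* §2 THE RANK-ONE GRAM READING: `conjTranspose_mul_vecMulVec_mul` (`Aᴴ (v vᴴ) A = (Aᴴv)(Aᴴv)ᴴ`), `vecMulVec_star_apply_same` (its diagonal is `|(Aᴴv)_k|²`),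
  `norm_smul_vecMulVec_apply` (`|(c·v vᴴ)_{ij}| = c|v_i||v_j|` for `c ≥ 0`), and the head **`rankOne_entry_le_movedGram`**:
  `c·|v_i|·|v_j| ≤ n·M²·(c·Σ_k |(Aᴴ v)_k|²)` — every entry of the rank-one index `S = c·v vᴴ` (hence `τ_w(S)`) is dominated by the moved line Gram `Σ_k (Aᴴ S A)_{kk}`,
  with the constant `n M²` of the height currency (`a′ = 2` in `hdecb`).
EDITION 2 (on the (K1b-♮) writer's binder bytes): the `ĝ`-cancellation identity `|σ♭(S)|_w·‖a₀₀(x(Λĝ·h)_w)‖² = …` in the currency of ★ p862643 `conj_index_eq_single` ∕ ★ (T4-β)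
`exists_lineChart` ∕ ★ p862629, and the assembled (ρ4) letter.
[BorelJacquet1979, §1.2, §4.1]; [MoeglinWaldspurger1995, I.2.2, II.1.5]; [Shimura1997, §A3] (height bookkeeping of Iwasawa blocks).
HONEST LABEL.  Count-neutral helper, closes no socket: `HC_CM` is proved only modulo the 7 printed citations (2 remaining named inputs: hLiu418 =
`stmt-HodgeConjecture-24832`, h413 = `stmt-HodgeConjecture-24833`) until rung 0 closes.
-/

set_option autoImplicit false
set_option linter.dupNamespace false -- the mandated namespace repeats `HodgeConjecture.HodgeConjecture`

noncomputable section

open Matrix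
open scoped ComplexConjugate Matrix BigOperators

namespace Summit.HodgeConjecture.HodgeConjecture.Cruxes.HLiu418.K2LiuKindOneLineCornerGramBound

variable {n : ℕ}

/-! ## §1 A vector is controlled by its image under `Aᴴ` when `A⁻¹` has bounded entries -/

/-- `A·A′ = 1 ⟹ A′ᴴ·Aᴴ = 1`. [folklore] -/
theorem conjTranspose_mul_conjTranspose_eq_one {A A' : Matrix (Fin n) (Fin n) ℂ} (h : A * A' = 1) : A'ᴴ * Aᴴ = 1 := by
  rw [← conjTranspose_mul, h, conjTranspose_one]

/-- **`|v_i| ≤ M · Σ_k |(Aᴴ v)_k|`** when `A·A′ = 1` and the entries of `A′` are bounded by `M`: `v = A′ᴴ (Aᴴ v)`, so `v_i = Σ_k conj(A′_{ki}) (Aᴴ v)_k`.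
[cite: BorelJacquet1979, §1.2, §4.1] [cite: MoeglinWaldspurger1995, I.2.2] -/
theorem norm_apply_le_of_mul_eq_one {A A' : Matrix (Fin n) (Fin n) ℂ} (h : A * A' = 1) {M : ℝ} (hM : ∀ k l, ‖A' k l‖ ≤ M)
    (v : Fin n → ℂ) (i : Fin n) :
    ‖v i‖ ≤ M * ∑ k, ‖(Aᴴ *ᵥ v) k‖ := by
  have hv : v = A'ᴴ *ᵥ (Aᴴ *ᵥ v) := by
    rw [mulVec_mulVec, conjTranspose_mul_conjTranspose_eq_one h, one_mulVec]
  have hvi : v i = ∑ k, A'ᴴ i k * (Aᴴ *ᵥ v) k := by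
    conv_lhs => rw [hv]
    rfl
  rw [hvi, Finset.mul_sum]
  refine (norm_sum_le _ _).trans (Finset.sum_le_sum fun k _ => ?_)
  rw [norm_mul, conjTranspose_apply, Complex.star_def, Complex.norm_conj]
  exact mul_le_mul_of_nonneg_right (hM k i) (norm_nonneg _)

/-- **`|v_i|² ≤ n·M²·Σ_k |(Aᴴ v)_k|²`** (§1 squared, Cauchy–Schwarz `(Σ_k x_k)² ≤ n Σ_k x_k²`): the eigenvalue-free form of `λ_min(A Aᴴ) ≥ (n M²)⁻¹`.
[cite: BorelJacquet1979, §1.2, §4.1] [cite: MoeglinWaldspurger1995, I.2.2] -/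
theorem norm_apply_sq_le {A A' : Matrix (Fin n) (Fin n) ℂ} (h : A * A' = 1) {M : ℝ} (hM : ∀ k l, ‖A' k l‖ ≤ M)
    (v : Fin n → ℂ) (i : Fin n) :
    ‖v i‖ ^ 2 ≤ n * M ^ 2 * ∑ k, ‖(Aᴴ *ᵥ v) k‖ ^ 2 := by
  have hM0 : 0 ≤ M := by
    rcases Nat.eq_zero_or_pos n with hn | hn
    · subst hn; exact absurd i.2 (Nat.not_lt_zero _)
    · exact (norm_nonneg _).trans (hM ⟨0, hn⟩ ⟨0, hn⟩)
  have h1 := norm_apply_le_of_mul_eq_one h hM v i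
  have hS0 : 0 ≤ ∑ k, ‖(Aᴴ *ᵥ v) k‖ := Finset.sum_nonneg fun k _ => norm_nonneg _
  have h2 : ‖v i‖ ^ 2 ≤ (M * ∑ k, ‖(Aᴴ *ᵥ v) k‖) ^ 2 := pow_le_pow_left₀ (norm_nonneg _) h1 2
  -- Cauchy–Schwarz in the form `(Σ_k x_k)² ≤ #s · Σ_k x_k²`
  have hcs : (∑ k, ‖(Aᴴ *ᵥ v) k‖) ^ 2 ≤ (Finset.univ : Finset (Fin n)).card * ∑ k, ‖(Aᴴ *ᵥ v) k‖ ^ 2 :=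
    sq_sum_le_card_mul_sum_sq
  rw [Finset.card_univ, Fintype.card_fin] at hcs
  calc ‖v i‖ ^ 2 ≤ (M * ∑ k, ‖(Aᴴ *ᵥ v) k‖) ^ 2 := h2
    _ = M ^ 2 * (∑ k, ‖(Aᴴ *ᵥ v) k‖) ^ 2 := by ring
    _ ≤ M ^ 2 * (n * ∑ k, ‖(Aᴴ *ᵥ v) k‖ ^ 2) := mul_le_mul_of_nonneg_left hcs (sq_nonneg _)
    _ = n * M ^ 2 * ∑ k, ‖(Aᴴ *ᵥ v) k‖ ^ 2 := by ring

/-! ## §2 The rank-one Gram reading -/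

/-- **`Aᴴ · (v vᴴ) · A = (Aᴴ v)(Aᴴ v)ᴴ`** (`v vᴴ = vecMulVec v (star v)`). [folklore] -/
theorem conjTranspose_mul_vecMulVec_mul (A : Matrix (Fin n) (Fin n) ℂ) (v : Fin n → ℂ) :
    Aᴴ * vecMulVec v (star v) * A = vecMulVec (Aᴴ *ᵥ v) (star (Aᴴ *ᵥ v)) := by
  rw [Matrix.mul_vecMulVec, Matrix.vecMulVec_mul, star_mulVec, conjTranspose_conjTranspose]

/-- the diagonal of `w wᴴ` is `|w_k|²`. [folklore] -/
theorem vecMulVec_star_apply_same (w : Fin n → ℂ) (k : Fin n) : vecMulVec w (star w) k k = ((‖w k‖ ^ 2 : ℝ) : ℂ) := by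
  rw [vecMulVec_apply, Pi.star_apply, Complex.star_def, Complex.mul_conj, Complex.normSq_eq_norm_sq]

/-- hence `(Aᴴ (v vᴴ) A)_{kk} = |(Aᴴ v)_k|²` and **`Σ_k (Aᴴ (v vᴴ) A)_{kk} = Σ_k |(Aᴴ v)_k|²`** — the moved line Gram is the quantity of §1. [folklore] -/
theorem sum_diag_conjTranspose_mul_vecMulVec_mul (A : Matrix (Fin n) (Fin n) ℂ) (v : Fin n → ℂ) :
    ∑ k, (Aᴴ * vecMulVec v (star v) * A) k k = (((∑ k, ‖(Aᴴ *ᵥ v) k‖ ^ 2 : ℝ)) : ℂ) := by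
  rw [conjTranspose_mul_vecMulVec_mul, Complex.ofReal_sum]
  exact Finset.sum_congr rfl fun k _ => vecMulVec_star_apply_same _ k

/-- the entries of the rank-one index: `|(c·v vᴴ)_{ij}| = c·|v_i|·|v_j|` for a real `c ≥ 0`. [folklore] -/
theorem norm_smul_vecMulVec_apply {c : ℝ} (hc : 0 ≤ c) (v : Fin n → ℂ) (i j : Fin n) :
    ‖((c : ℂ) • vecMulVec v (star v)) i j‖ = c * (‖v i‖ * ‖v j‖) := by
  rw [Matrix.smul_apply, vecMulVec_apply, Pi.star_apply, smul_eq_mul, norm_mul, norm_mul, Complex.norm_real, Real.norm_of_nonneg hc,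
    Complex.star_def, Complex.norm_conj]

/-- **(ρ4) CORE — EVERY ENTRY OF THE RANK-ONE INDEX IS DOMINATED BY THE MOVED LINE GRAM.**  For `A·A′ = 1` with `|A′_{kl}| ≤ M` (the inverse Iwasawa Levi block in the height
currency, ★ G7-B `block_entry_bounds`: `M ~ H(h_∞)`), a real `c ≥ 0` and any `v`: `|(c·v vᴴ)_{ij}| ≤ n·M²·(c·Σ_k |(Aᴴ v)_k|²)` — i.e. `τ_w(S) ≤ n M² · Σ_k (Aᴴ S A)_{kk}` for the
rank-one index `S = c·v vᴴ`; read backwards, `Σ_k (Aᴴ S A)_{kk} ≥ (n M²)⁻¹ τ_w(S) ≳ H(h_∞)^{−2} τ_w(S)` — the exponent of `hdecb` with `a′ = 2` and an absolute `c`.  (`|v_i||v_j| ≤ ½(|v_i|² + |v_j|²)`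
and §1.) [cite: BorelJacquet1979, §1.2, §4.1] [cite: MoeglinWaldspurger1995, I.2.2, II.1.5] [cite: Shimura1997, §A3] -/
theorem rankOne_entry_le_movedGram {A A' : Matrix (Fin n) (Fin n) ℂ} (h : A * A' = 1) {M : ℝ} (hM : ∀ k l, ‖A' k l‖ ≤ M)
    {c : ℝ} (hc : 0 ≤ c) (v : Fin n → ℂ) (i j : Fin n) :
    ‖((c : ℂ) • vecMulVec v (star v)) i j‖ ≤ n * M ^ 2 * (c * ∑ k, ‖(Aᴴ *ᵥ v) k‖ ^ 2) := by
  rw [norm_smul_vecMulVec_apply hc]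
  have hi := norm_apply_sq_le h hM v i
  have hj := norm_apply_sq_le h hM v j
  have hG0 : 0 ≤ n * M ^ 2 * ∑ k, ‖(Aᴴ *ᵥ v) k‖ ^ 2 := le_trans (sq_nonneg _) hi
  -- `|v_i| |v_j| ≤ ½ (|v_i|² + |v_j|²) ≤ n M² Σ_k |(Aᴴ v)_k|²`
  have hprod : ‖v i‖ * ‖v j‖ ≤ n * M ^ 2 * ∑ k, ‖(Aᴴ *ᵥ v) k‖ ^ 2 := by
    nlinarith [sq_nonneg (‖v i‖ - ‖v j‖), norm_nonneg (v i), norm_nonneg (v j)]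
  calc c * (‖v i‖ * ‖v j‖) ≤ c * (n * M ^ 2 * ∑ k, ‖(Aᴴ *ᵥ v) k‖ ^ 2) := mul_le_mul_of_nonneg_left hprod hc
    _ = n * M ^ 2 * (c * ∑ k, ‖(Aᴴ *ᵥ v) k‖ ^ 2) := by ring

/-- the same read with the index itself: for `S = c·v vᴴ`, `|S_{ij}| ≤ n·M²·re (Σ_k (Aᴴ S A)_{kk})` (the moved Gram's diagonal sum is real and equals `c·Σ_k |(Aᴴ v)_k|²`).
[cite: MoeglinWaldspurger1995, II.1.5] [cite: Shimura1997, §A3] -/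
theorem rankOne_entry_le_re_sum_diag {A A' : Matrix (Fin n) (Fin n) ℂ} (h : A * A' = 1) {M : ℝ} (hM : ∀ k l, ‖A' k l‖ ≤ M)
    {c : ℝ} (hc : 0 ≤ c) (v : Fin n → ℂ) (i j : Fin n) :
    ‖((c : ℂ) • vecMulVec v (star v)) i j‖ ≤ n * M ^ 2 * (∑ k, (Aᴴ * ((c : ℂ) • vecMulVec v (star v)) * A) k k).re := by
  have hsum : (∑ k, (Aᴴ * ((c : ℂ) • vecMulVec v (star v)) * A) k k) = ((c * ∑ k, ‖(Aᴴ *ᵥ v) k‖ ^ 2 : ℝ) : ℂ) := by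
    rw [Matrix.mul_smul, Matrix.smul_mul, Complex.ofReal_mul, ← sum_diag_conjTranspose_mul_vecMulVec_mul, Finset.mul_sum]
    exact Finset.sum_congr rfl fun k _ => by rw [Matrix.smul_apply, smul_eq_mul]
  rw [hsum, Complex.ofReal_re]
  exact rankOne_entry_le_movedGram h hM hc v i j

/-! ## §3 Edition 2 (append-only): the `ĝ`-CANCELLATION — the rank-one index against the corner row of the moved Levi block -/

/-- `Aᴴ (star r) = star (r ᵥ* A)` entrywise in norm: `Σ_k ‖(Aᴴ *ᵥ star r)_k‖² = Σ_k ‖(r ᵥ* A)_k‖²` (the ROW `r` moved by `A` on the right). [folklore] -/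
theorem sum_norm_sq_conjTranspose_mulVec_star (A : Matrix (Fin n) (Fin n) ℂ) (r : Fin n → ℂ) :
    ∑ k, ‖(Aᴴ *ᵥ star r) k‖ ^ 2 = ∑ k, ‖(r ᵥ* A) k‖ ^ 2 := by
  rw [← Matrix.star_vecMul]
  exact Finset.sum_congr rfl fun k _ => by rw [Pi.star_apply, norm_star]

/-- hence ★ ED. 1 §1 for a ROW: `‖r_i‖² ≤ n·M²·Σ_k ‖(r ᵥ* A)_k‖²` when `A·A′ = 1`, `|A′_{kl}| ≤ M`. [cite: BorelJacquet1979, §1.2, §4.1] -/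
theorem norm_row_apply_sq_le {A A' : Matrix (Fin n) (Fin n) ℂ} (h : A * A' = 1) {M : ℝ} (hM : ∀ k l, ‖A' k l‖ ≤ M) (r : Fin n → ℂ) (i : Fin n) :
    ‖r i‖ ^ 2 ≤ n * M ^ 2 * ∑ k, ‖(r ᵥ* A) k‖ ^ 2 := by
  have h1 := norm_apply_sq_le h hM (star r) i
  rw [Pi.star_apply, norm_star, sum_norm_sq_conjTranspose_mulVec_star] at h1
  exact h1

/-- **THE RANK-ONE INDEX IN TERMS OF THE CORNER ROW (the `ĝ`-cancellation, entrywise).**  Arch images at a complex place `w` of ★ p862643's letters, BY VALUE: the Levi relation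
of the rational Levi element `Λĝ` — `ĝᴴ · T · D₀ = T` (`T = T_L` DIAGONAL, `c ↦ conj`) — and the corner law `D₀ · S = σ♭ · E₁₁ · ĝ` (`D₀ S ĝ⁻¹ = σ♭ E₁₁`, inverse-free).  THEN
`T_i · S_{ij} = σ♭ · conj(ĝ_{0i}) · T_0 · ĝ_{0j}`: `S` is `σ♭` times the `T`-twisted Gram of the FIRST ROW of `ĝ` — `D₀` is gone. [cite: MoeglinWaldspurger1995, II.1.7] [cite: Shimura1997, §18.4] -/
theorem diag_mul_cornerIndex_apply (T : Fin n → ℂ) (g D₀ S : Matrix (Fin n) (Fin n) ℂ) (σ : ℂ) (i₀ : Fin n)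
    (hLevi : gᴴ * diagonal T * D₀ = diagonal T) (hS : D₀ * S = σ • (Matrix.single i₀ i₀ (1 : ℂ) * g)) (i j : Fin n) :
    T i * S i j = σ * ((starRingEnd ℂ) (g i₀ i) * T i₀ * g i₀ j) := by
  have hkey : diagonal T * S = σ • (gᴴ * diagonal T * (Matrix.single i₀ i₀ (1 : ℂ) * g)) := by
    calc diagonal T * S = gᴴ * diagonal T * D₀ * S := by rw [hLevi]
      _ = gᴴ * diagonal T * (D₀ * S) := by simp only [Matrix.mul_assoc]
      _ = σ • (gᴴ * diagonal T * (Matrix.single i₀ i₀ (1 : ℂ) * g)) := by rw [hS, Matrix.mul_smul]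
  have hij := congrFun (congrFun hkey i) j
  rw [diagonal_mul, Matrix.smul_apply, smul_eq_mul] at hij
  rw [hij]
  congr 1
  -- `(gᴴ · diag T · E_{i₀i₀} · g)_{ij} = conj(g_{i₀ i}) · T_{i₀} · g_{i₀ j}`
  have hEg : ∀ a, (Matrix.single i₀ i₀ (1 : ℂ) * g) a j = if a = i₀ then g i₀ j else 0 := fun a => by
    rw [Matrix.mul_apply]
    by_cases ha : a = i₀
    · subst ha
      rw [if_pos rfl, Finset.sum_eq_single a (fun b _ hb => by rw [Matrix.single_apply_of_ne (h := fun h => hb h.2.symm), zero_mul]) (fun h => absurd (Finset.mem_univ a) h),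
        Matrix.single_apply_same, one_mul]
    · rw [if_neg ha]
      exact Finset.sum_eq_zero fun b _ => by rw [Matrix.single_apply_of_ne (h := fun h => ha h.1.symm), zero_mul]
  rw [Matrix.mul_apply, Finset.sum_eq_single i₀ (fun a _ ha => by rw [hEg a, if_neg ha, mul_zero]) (fun h => absurd (Finset.mem_univ i₀) h), hEg i₀, if_pos rfl,
    Matrix.mul_apply, Finset.sum_eq_single i₀ (fun b _ hb => by rw [diagonal_apply_ne _ hb, mul_zero]) (fun h => absurd (Finset.mem_univ i₀) h), diagonal_apply_eq,
    conjTranspose_apply, Complex.star_def]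

/-- **(ρ4) — THE CORNER GRAM BOUND WITH THE `ĝ`-CANCELLATION (edition 2 head).**  Per complex place, in the tube∕matrix frame over `ℂ`, all letters BY VALUE: `T` diagonal
with non-zero entries (`T_L` at `w`), the Levi relation `ĝᴴ T D₀ = T` and the corner law `D₀ S = σ♭ E_{i₀i₀} ĝ` of ★ p862643 (arch images, `c ↦ conj`), and the Iwasawa Levi block
`A` of `h_w` with `A A′ = 1`, `|A′_{kl}| ≤ M` (★ G7-B `block_entry_bounds`, `M ~ H(h_∞)`).  THEN for all `i j`:
`‖S_{ij}‖ ≤ (‖T_{i₀}‖ · max_k ‖T_k⁻¹‖) · (n M²) · (‖σ♭‖ · Σ_k ‖(ĝ_{i₀ •} ᵥ* A)_k‖²)` — and `Σ_k ‖(ĝ_{i₀•} ᵥ* A)_k‖² = ‖e_{i₀}ᵀ ĝ A‖²` is the corner Levi coordinate `‖a₀₀((Λĝ·h)_w)‖²`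
(the Levi block of `(Λĝ h)_w` is `ĝ_w A_w`; (P-dec) reads it BY VALUE).  Read backwards: `|σ♭|_w · ‖a₀₀‖² ≥ (n M² C_T)⁻¹ · ‖S‖_w ≳ H(h_∞)^{−2} · τ_w(S)` — the `hdecb` exponent with
`a′ = 2`; `D₀` and the row section behind `ĝ` have CANCELLED. [cite: BorelJacquet1979, §1.2, §4.1] [cite: MoeglinWaldspurger1995, I.2.2, II.1.5, II.1.7] [cite: Shimura1997, §18.4, §A3] -/
theorem cornerIndex_entry_le (T : Fin n → ℂ) (hT : ∀ i, T i ≠ 0) (g D₀ S : Matrix (Fin n) (Fin n) ℂ) (σ : ℂ) (i₀ : Fin n)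
    (hLevi : gᴴ * diagonal T * D₀ = diagonal T) (hS : D₀ * S = σ • (Matrix.single i₀ i₀ (1 : ℂ) * g))
    {A A' : Matrix (Fin n) (Fin n) ℂ} (hA : A * A' = 1) {M : ℝ} (hM : ∀ k l, ‖A' k l‖ ≤ M)
    {CT : ℝ} (hCT : ∀ i, ‖T i₀‖ * ‖(T i)⁻¹‖ ≤ CT) (i j : Fin n) :
    ‖S i j‖ ≤ CT * (n * M ^ 2) * (‖σ‖ * ∑ k, ‖((fun l => g i₀ l) ᵥ* A) k‖ ^ 2) := by
  have hentry := diag_mul_cornerIndex_apply T g D₀ S σ i₀ hLevi hS i j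
  have hSij : S i j = (T i)⁻¹ * (σ * ((starRingEnd ℂ) (g i₀ i) * T i₀ * g i₀ j)) := by
    rw [← hentry, ← mul_assoc, inv_mul_cancel₀ (hT i), one_mul]
  -- the row bound from ★ ED. 1 (`r = ĝ_{i₀ •}`)
  have hi := norm_row_apply_sq_le hA hM (fun l => g i₀ l) i
  have hj := norm_row_apply_sq_le hA hM (fun l => g i₀ l) j
  have hG0 : 0 ≤ (n : ℝ) * M ^ 2 * ∑ k, ‖((fun l => g i₀ l) ᵥ* A) k‖ ^ 2 := le_trans (sq_nonneg _) hi
  have hprod : ‖g i₀ i‖ * ‖g i₀ j‖ ≤ n * M ^ 2 * ∑ k, ‖((fun l => g i₀ l) ᵥ* A) k‖ ^ 2 := by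
    have hi' : ‖g i₀ i‖ ^ 2 ≤ n * M ^ 2 * ∑ k, ‖((fun l => g i₀ l) ᵥ* A) k‖ ^ 2 := hi
    have hj' : ‖g i₀ j‖ ^ 2 ≤ n * M ^ 2 * ∑ k, ‖((fun l => g i₀ l) ᵥ* A) k‖ ^ 2 := hj
    nlinarith [sq_nonneg (‖g i₀ i‖ - ‖g i₀ j‖), norm_nonneg (g i₀ i), norm_nonneg (g i₀ j)]
  have hCT0 : 0 ≤ CT := le_trans (mul_nonneg (norm_nonneg _) (norm_nonneg _)) (hCT i)
  calc ‖S i j‖ = ‖T i₀‖ * ‖(T i)⁻¹‖ * (‖σ‖ * (‖g i₀ i‖ * ‖g i₀ j‖)) := by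
        rw [hSij, norm_mul, norm_mul, norm_mul, norm_mul, Complex.norm_conj]; ring
    _ ≤ CT * (‖σ‖ * (n * M ^ 2 * ∑ k, ‖((fun l => g i₀ l) ᵥ* A) k‖ ^ 2)) :=
        mul_le_mul (hCT i) (mul_le_mul_of_nonneg_left hprod (norm_nonneg _)) (mul_nonneg (norm_nonneg _) (mul_nonneg (norm_nonneg _) (norm_nonneg _))) hCT0
    _ = CT * (n * M ^ 2) * (‖σ‖ * ∑ k, ‖((fun l => g i₀ l) ᵥ* A) k‖ ^ 2) := by ring

/-- the same AGAINST THE CORNER LEVI COORDINATE read by value (`ha : Σ_k ‖(ĝ_{i₀•} ᵥ* A)_k‖² ≤ a²`, e.g. `=`): `‖S_{ij}‖ ≤ C_T · n M² · (‖σ♭‖ · a²)` — the shape (P-dec) consumes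
(`|σ♭|_w·‖a₀₀((Λĝ·h)_w)‖² ≥ κ·H(h_∞)^{−2}·‖S‖_w`, `κ = (n M² C_T)⁻¹·H²∕M²`-bookkeeping on the consumer's side). [cite: MoeglinWaldspurger1995, II.1.5, II.1.7] [cite: Shimura1997, §A3] -/
theorem cornerIndex_entry_le_of_levi_coord (T : Fin n → ℂ) (hT : ∀ i, T i ≠ 0) (g D₀ S : Matrix (Fin n) (Fin n) ℂ) (σ : ℂ) (i₀ : Fin n)
    (hLevi : gᴴ * diagonal T * D₀ = diagonal T) (hS : D₀ * S = σ • (Matrix.single i₀ i₀ (1 : ℂ) * g))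
    {A A' : Matrix (Fin n) (Fin n) ℂ} (hA : A * A' = 1) {M : ℝ} (hM : ∀ k l, ‖A' k l‖ ≤ M)
    {CT : ℝ} (hCT : ∀ i, ‖T i₀‖ * ‖(T i)⁻¹‖ ≤ CT) {a : ℝ} (ha : ∑ k, ‖((fun l => g i₀ l) ᵥ* A) k‖ ^ 2 ≤ a ^ 2) (i j : Fin n) :
    ‖S i j‖ ≤ CT * (n * M ^ 2) * (‖σ‖ * a ^ 2) := by
  have hCT0 : 0 ≤ CT := le_trans (mul_nonneg (norm_nonneg _) (norm_nonneg _)) (hCT i)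
  exact (cornerIndex_entry_le T hT g D₀ S σ i₀ hLevi hS hA hM hCT i j).trans
    (mul_le_mul_of_nonneg_left (mul_le_mul_of_nonneg_left ha (norm_nonneg _)) (mul_nonneg hCT0 (mul_nonneg (Nat.cast_nonneg _) (sq_nonneg _))))

end Summit.HodgeConjecture.HodgeConjecture.Cruxes.HLiu418.K2LiuKindOneLineCornerGramBound

end
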